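import Summits.Parity.GeneralizedHardyLittlewood.Theorems.PrimeLevelFamEdgeMomentsBeyondDiagonalLayersClassBound
import Summits.Parity.GeneralizedHardyLittlewood.Theorems.PrimeLevelFamEdgeMomentsBeyondDiagonalLayersDilatedFourierBound
import HarnessLib

/-!
# Route `PrimeLevelFamEdge`, crux K_A `MomentsBeyondDiagonal` (stmt-Parity-20007), line «petersson_layers» v4:
# the PER-CLASS PARSEVAL FLOOR of `stub_farP`'s `k = 0` forms in closed form (assembly step E4'', UNCONDITIONAL)

Twin of `…LayersClassBound.norm_classForm_le_of_pascadi` with Pascadi's Theorem 7.1 replaced by the completion bound with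
multiplicity (`…LayersDilatedFourierBound.norm_bilinear_kloostermanSum_dilated_le`): for one `(d₁,d₂)`-block and one sharp class
`(s₁,t₁,s₂,t₂)` (class modulus `c' = qr/g`, dilations `σ₁' = s₁t₁/g`, `σ₂' = s₂t₂/g`, flat box `Z₁Z₂`, hyperbolic AFE length
`V = Y/(d₁t₁d₂t₂) ≤ W₁W₂`),
* **`norm_classForm_le_dilatedFourier`**:
  `‖class form‖ ≤ c' · √(Z₁Z₂/(c'/(σ₁',c')) + 1) · √(V/(c'/(σ₂',c')) + 1) · √D₁√D₂ · B²√(Z₁Z₂) · KL√((1+2log q)Y/(d₁t₁d₂t₂))`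
  — no ordering or length condition; this is the bound used for the classes whose dilated mollifier length exceeds the class
  modulus (census CENSUS-leafhand2-g2: there it wins by `x^{−0.53}`).
Remaining (census E5b/E6/E7): the sums over classes and blocks, `q ∣ r`, the final instantiation; NOT done here.
Proof only (def-free helper); K_A NOT proved; nothing about Landau–Siegel zeros.
-/

noncomputable section

open scoped Real Nat
open Complex Finset Polynomial MeasureTheory
open Literature.NumberTheory.LFunctions

namespace Summit.Parity.GeneralizedHardyLittlewood.Theorems.MomentsBeyondDiagonal.Layers

open Summit.Parity.GeneralizedHardyLittlewood.Theorems.PrimeLevelFamEdgeIdeaDeltas.PeterssonLayers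

/-- **The per-class Parseval floor with multiplicity** (any class modulus `c' = qr/g ≥ 1`; `q ≥ 64`; divisor bounds `D₁, D₂` as
hypotheses; `V = Y/(d₁t₁d₂t₂) ≤ W₁W₂`). [cite: KerrShparlinskiWuXi2023, §1.1 (the trivial Fourier bound)] -/
theorem norm_classForm_le_dilatedFourier {q : ℕ} [NeZero q] (h64 : 64 ≤ q) (r : ℕ) {P : ℝ[X]} {B : ℝ}
    (hB : ∀ t ∈ Set.Icc (0 : ℝ) 1, |P.eval t| ≤ B) {Δ' : ℝ} (hΔ' : 0 < Δ') (i j : ℕ) {K : ℝ} (hK0 : 0 ≤ K)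
    (hK : ∀ {N₁ N₂ : ℕ}, N₁ ∈ afeBox q → N₂ ∈ afeBox q →
      ‖((((N₁ : ℝ) * N₂) ^ (-(1 / 2 : ℝ)) : ℝ) : ℂ) * afeW (KMV2000.qhat q) i j N₁ N₂‖ *
          Real.sqrt ((N₁ : ℝ) * N₂) ≤
        K * ((1 + Real.log (KMV2000.qhat q)) * (1 + 2 * Real.log q)) ^ (i + j) *
          (KMV2000.qhat q ^ 2 / ((N₁ : ℝ) * N₂)) ^ (0 : ℝ))
    (Y : ℕ) {d₁ d₂ s₁ t₁ s₂ t₂ : ℕ} (g : ℕ) [NeZero (q * r / g)]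
    (hd₁ : 1 ≤ d₁) (hd₂ : 1 ≤ d₂) (hs₁ : 1 ≤ s₁) (hs₂ : 1 ≤ s₂) (ht₁ : 1 ≤ t₁) (ht₂ : 1 ≤ t₂)
    (hV : Y / (d₁ * t₁ * (d₂ * t₂)) ≤ (q ^ 2 / d₁ / t₁) * (q ^ 2 / d₂ / t₂))
    {D₁ D₂ : ℝ} (hD₁0 : 0 ≤ D₁) (hD₂0 : 0 ≤ D₂)
    (hD₁ : ∀ u ∈ Icc 1 ((⌊KMV2000.qhat q ^ Δ'⌋₊ / d₁ / s₁) * (⌊KMV2000.qhat q ^ Δ'⌋₊ / d₂ / s₂)), (#u.divisors : ℝ) ≤ D₁)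
    (hD₂ : ∀ v ∈ Icc 1 ((q ^ 2 / d₁ / t₁) * (q ^ 2 / d₂ / t₂)), (#v.divisors : ℝ) ≤ D₂) :
    ‖∑ f₁ ∈ Icc 1 (⌊KMV2000.qhat q ^ Δ'⌋₊ / d₁ / s₁), ∑ h₁ ∈ Icc 1 (q ^ 2 / d₁ / t₁),
      ∑ f₂ ∈ Icc 1 (⌊KMV2000.qhat q ^ Δ'⌋₊ / d₂ / s₂), ∑ h₂ ∈ Icc 1 (q ^ 2 / d₂ / t₂),
        (if Nat.Coprime f₁ (q * r) ∧ Nat.Coprime f₂ (q * r) then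
            (KMV2000.mollifierCoeff P (KMV2000.qhat q ^ Δ') (d₁ * (s₁ * f₁)) : ℂ) *
              (KMV2000.mollifierCoeff P (KMV2000.qhat q ^ Δ') (d₂ * (s₂ * f₂)) : ℂ) *
              ((Real.sqrt ((s₁ * f₁ : ℕ) : ℝ) * Real.sqrt ((s₂ * f₂ : ℕ) : ℝ) : ℝ) : ℂ) else 0) *
          (if Nat.Coprime h₁ (q * r) ∧ Nat.Coprime h₂ (q * r) then
              (if d₁ * (t₁ * h₁) * (d₂ * (t₂ * h₂)) ≤ Y then
                  ((((((d₁ * (t₁ * h₁) : ℕ) : ℝ) * ((d₂ * (t₂ * h₂) : ℕ) : ℝ)) ^ (-(1 / 2 : ℝ)) : ℝ) : ℂ) *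
                    afeW (KMV2000.qhat q) i j (d₁ * (t₁ * h₁)) (d₂ * (t₂ * h₂))) else 0) *
                ((Real.sqrt ((t₁ * h₁ : ℕ) : ℝ) * Real.sqrt ((t₂ * h₂ : ℕ) : ℝ) : ℝ) : ℂ) else 0) *
          kloostermanSum (q * r / g) ((s₁ * t₁ / g * (f₁ * f₂) : ℕ) : ZMod (q * r / g))
            ((s₂ * t₂ / g * (h₁ * h₂) : ℕ) : ZMod (q * r / g))‖ ≤
      ((q * r / g : ℕ) : ℝ) *
        Real.sqrt ((((⌊KMV2000.qhat q ^ Δ'⌋₊ / d₁ / s₁) * (⌊KMV2000.qhat q ^ Δ'⌋₊ / d₂ / s₂)) /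
            ((q * r / g) / Nat.gcd (s₁ * t₁ / g) (q * r / g)) + 1 : ℕ) : ℝ) *
        Real.sqrt (((Y / (d₁ * t₁ * (d₂ * t₂))) / ((q * r / g) / Nat.gcd (s₂ * t₂ / g) (q * r / g)) + 1 : ℕ) : ℝ) *
        (Real.sqrt D₁ * (B ^ 2 * Real.sqrt (((⌊KMV2000.qhat q ^ Δ'⌋₊ / d₁ / s₁ : ℕ) : ℝ) * ((⌊KMV2000.qhat q ^ Δ'⌋₊ / d₂ / s₂ : ℕ) : ℝ)))) *
        (Real.sqrt D₂ * (K * ((1 + Real.log (KMV2000.qhat q)) * (1 + 2 * Real.log q)) ^ (i + j) *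
          Real.sqrt ((1 + 2 * Real.log q) * ((Y : ℝ) / (((d₁ * t₁ : ℕ) : ℝ) * ((d₂ * t₂ : ℕ) : ℝ)))))) := by
  set c' : ℕ := q * r / g with hc'
  set Z₁ : ℕ := ⌊KMV2000.qhat q ^ Δ'⌋₊ / d₁ / s₁ with hZ₁
  set Z₂ : ℕ := ⌊KMV2000.qhat q ^ Δ'⌋₊ / d₂ / s₂ with hZ₂
  set V : ℕ := Y / (d₁ * t₁ * (d₂ * t₂)) with hVdef
  have hD : 0 < d₁ * t₁ * (d₂ * t₂) := by positivity
  -- the hyperbolic support of `B_t`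
  have hBsupp : ∀ n₁ n₂ : ℕ, V < n₁ * n₂ →
      (if Nat.Coprime n₁ (q * r) ∧ Nat.Coprime n₂ (q * r) then
          (if d₁ * (t₁ * n₁) * (d₂ * (t₂ * n₂)) ≤ Y then
              ((((((d₁ * (t₁ * n₁) : ℕ) : ℝ) * ((d₂ * (t₂ * n₂) : ℕ) : ℝ)) ^ (-(1 / 2 : ℝ)) : ℝ) : ℂ) *
                afeW (KMV2000.qhat q) i j (d₁ * (t₁ * n₁)) (d₂ * (t₂ * n₂))) else 0) *
            ((Real.sqrt ((t₁ * n₁ : ℕ) : ℝ) * Real.sqrt ((t₂ * n₂ : ℕ) : ℝ) : ℝ) : ℂ) else 0) = 0 :=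
    fun n₁ n₂ hlt ↦ classAFE_eq_zero_of_lt hD
      (fun N₁ N₂ ↦ ((((N₁ : ℝ) * (N₂ : ℝ)) ^ (-(1 / 2 : ℝ)) : ℝ) : ℂ) * afeW (KMV2000.qhat q) i j N₁ N₂)
      (q * r) (fun n₁ n₂ ↦ ((Real.sqrt ((t₁ * n₁ : ℕ) : ℝ) * Real.sqrt ((t₂ * n₂ : ℕ) : ℝ) : ℝ) : ℂ)) hlt
  -- regroup on the hyperbolic box
  rw [sum_four_eq_bilinear_fiber_hyperbolic Z₁ Z₂ (q ^ 2 / d₁ / t₁) (q ^ 2 / d₂ / t₂) V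
    (fun f₁ f₂ ↦ (if Nat.Coprime f₁ (q * r) ∧ Nat.Coprime f₂ (q * r) then
        (KMV2000.mollifierCoeff P (KMV2000.qhat q ^ Δ') (d₁ * (s₁ * f₁)) : ℂ) *
          (KMV2000.mollifierCoeff P (KMV2000.qhat q ^ Δ') (d₂ * (s₂ * f₂)) : ℂ) *
          ((Real.sqrt ((s₁ * f₁ : ℕ) : ℝ) * Real.sqrt ((s₂ * f₂ : ℕ) : ℝ) : ℝ) : ℂ) else 0))
    (fun h₁ h₂ ↦ (if Nat.Coprime h₁ (q * r) ∧ Nat.Coprime h₂ (q * r) then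
        (if d₁ * (t₁ * h₁) * (d₂ * (t₂ * h₂)) ≤ Y then
            ((((((d₁ * (t₁ * h₁) : ℕ) : ℝ) * ((d₂ * (t₂ * h₂) : ℕ) : ℝ)) ^ (-(1 / 2 : ℝ)) : ℝ) : ℂ) *
              afeW (KMV2000.qhat q) i j (d₁ * (t₁ * h₁)) (d₂ * (t₂ * h₂))) else 0) *
          ((Real.sqrt ((t₁ * h₁ : ℕ) : ℝ) * Real.sqrt ((t₂ * h₂ : ℕ) : ℝ) : ℝ) : ℂ) else 0))
    (fun u v ↦ kloostermanSum c' ((s₁ * t₁ / g * u : ℕ) : ZMod c') ((s₂ * t₂ / g * v : ℕ) : ZMod c')) hBsupp,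
    min_eq_left hV]
  -- the completion bound with multiplicity
  have hm₁ := fun u (_ : u ∈ Icc 1 (Z₁ * Z₂)) ↦ card_filter_dilate_congr_le (c := c') (s₁ * t₁ / g) (Z₁ * Z₂) u
  have hm₂ := fun v (_ : v ∈ Icc 1 V) ↦ card_filter_dilate_congr_le (c := c') (s₂ * t₂ / g) V v
  refine (norm_bilinear_kloostermanSum_dilated_le (c := c') (Icc 1 (Z₁ * Z₂)) (Icc 1 V)
    (fun u ↦ ((s₁ * t₁ / g * u : ℕ) : ZMod c')) (fun v ↦ ((s₂ * t₂ / g * v : ℕ) : ZMod c')) hm₁ hm₂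
    (fun u ↦ ∑ p ∈ (Icc 1 Z₁ ×ˢ Icc 1 Z₂).filter (fun p : ℕ × ℕ ↦ p.1 * p.2 = u),
      (fun f₁ f₂ ↦ (if Nat.Coprime f₁ (q * r) ∧ Nat.Coprime f₂ (q * r) then
        (KMV2000.mollifierCoeff P (KMV2000.qhat q ^ Δ') (d₁ * (s₁ * f₁)) : ℂ) *
          (KMV2000.mollifierCoeff P (KMV2000.qhat q ^ Δ') (d₂ * (s₂ * f₂)) : ℂ) *
          ((Real.sqrt ((s₁ * f₁ : ℕ) : ℝ) * Real.sqrt ((s₂ * f₂ : ℕ) : ℝ) : ℝ) : ℂ) else 0)) p.1 p.2)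
    (fun v ↦ ∑ p ∈ (Icc 1 (q ^ 2 / d₁ / t₁) ×ˢ Icc 1 (q ^ 2 / d₂ / t₂)).filter (fun p : ℕ × ℕ ↦ p.1 * p.2 = v),
      (fun h₁ h₂ ↦ (if Nat.Coprime h₁ (q * r) ∧ Nat.Coprime h₂ (q * r) then
        (if d₁ * (t₁ * h₁) * (d₂ * (t₂ * h₂)) ≤ Y then
            ((((((d₁ * (t₁ * h₁) : ℕ) : ℝ) * ((d₂ * (t₂ * h₂) : ℕ) : ℝ)) ^ (-(1 / 2 : ℝ)) : ℝ) : ℂ) *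
              afeW (KMV2000.qhat q) i j (d₁ * (t₁ * h₁)) (d₂ * (t₂ * h₂))) else 0) *
          ((Real.sqrt ((t₁ * h₁ : ℕ) : ℝ) * Real.sqrt ((t₂ * h₂ : ℕ) : ℝ) : ℝ) : ℂ) else 0)) p.1 p.2)).trans ?_
  -- the `ℓ²` sizes
  obtain ⟨h1, h2⟩ := sqrt_fiber_norms_le hV
    (fun f₁ f₂ ↦ (if Nat.Coprime f₁ (q * r) ∧ Nat.Coprime f₂ (q * r) then
        (KMV2000.mollifierCoeff P (KMV2000.qhat q ^ Δ') (d₁ * (s₁ * f₁)) : ℂ) *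
          (KMV2000.mollifierCoeff P (KMV2000.qhat q ^ Δ') (d₂ * (s₂ * f₂)) : ℂ) *
          ((Real.sqrt ((s₁ * f₁ : ℕ) : ℝ) * Real.sqrt ((s₂ * f₂ : ℕ) : ℝ) : ℝ) : ℂ) else 0))
    (fun h₁ h₂ ↦ (if Nat.Coprime h₁ (q * r) ∧ Nat.Coprime h₂ (q * r) then
        (if d₁ * (t₁ * h₁) * (d₂ * (t₂ * h₂)) ≤ Y then
            ((((((d₁ * (t₁ * h₁) : ℕ) : ℝ) * ((d₂ * (t₂ * h₂) : ℕ) : ℝ)) ^ (-(1 / 2 : ℝ)) : ℝ) : ℂ) *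
              afeW (KMV2000.qhat q) i j (d₁ * (t₁ * h₁)) (d₂ * (t₂ * h₂))) else 0) *
          ((Real.sqrt ((t₁ * h₁ : ℕ) : ℝ) * Real.sqrt ((t₂ * h₂ : ℕ) : ℝ) : ℝ) : ℂ) else 0)) hD₁0 hD₂0 hD₁ hD₂
  obtain ⟨hAs, hBs⟩ := sqrt_classCoeff_le h64 hB hΔ' i j hK0 (fun hN₁ hN₂ ↦ hK hN₁ hN₂) (q * r) Y hd₁ hd₂ hs₁ hs₂ ht₁ ht₂
  have hB0 : 0 ≤ B := le_trans (abs_nonneg _) (hB 0 (by simp))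
  have hX0 : 0 ≤ (c' : ℝ) *
      Real.sqrt (((Z₁ * Z₂) / (c' / Nat.gcd (s₁ * t₁ / g) c') + 1 : ℕ) : ℝ) *
      Real.sqrt ((V / (c' / Nat.gcd (s₂ * t₂ / g) c') + 1 : ℕ) : ℝ) := by positivity
  exact mul_le_mul (mul_le_mul_of_nonneg_left (h1.trans (mul_le_mul_of_nonneg_left hAs (Real.sqrt_nonneg _))) hX0)
    (h2.trans (mul_le_mul_of_nonneg_left hBs (Real.sqrt_nonneg _))) (Real.sqrt_nonneg _) (by positivity)

end Summit.Parity.GeneralizedHardyLittlewood.Theorems.MomentsBeyondDiagonal.Layers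

end
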